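import Mathlib
import HarnessLib
import HarnessLib.Audit
import Literature.InformationTheory.QuantumCodes.BivariateBicycleCodes
import Summits.Ventures.QEC.Census.BB.Claims

/-!
Route: BB72DistanceCertificate

CLOSED (proved) 2026-08-26T21:01:32Z by operator:999:1122764 — reason: proved:Summit.Ventures.QEC.Census.BB72.BB72_12_6_claim_holds. The file is kept as the record of this route; refuted decls are indexed as negative knowledge (`ledger negatives`).

# Route BB72DistanceCertificate — the [[72,12,6]] bivariate-bicycle code has distance exactly 6, by
certificate

It suffices to show X = (no Z-type logical operator of the bivariate-bicycle code QC(x³+y+y²,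
y³+x+x²) on ℤ₆ × ℤ₆ = `BB.bb72` has
Hamming weight ≤ 5) ∧ (some Z-type logical operator has weight exactly 6) ∧ (k = n − rk H^X − rk H^Z
= 12). X is the content of a
DISTANCE CERTIFICATE for the printed row [[72,12,6]] of Bravyi–Cross–Gambetta–Maslov–Rall–Yoder
(Nature 627 (2024) Table 1; distance
there "computed by the mixed integer programming approach", no certificate in print): lower bound =
an exhaustive enumeration / UNSAT
certificate re-checked in the kernel, upper bound = one explicit codeword, dimension = a rank
certificate. The route is the LADDER-QEC
rung-Q2 route of cell pub/qec (venture ruling D-0059/D-0061/D-0092): its deciding theorem concludes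
the registered CLAIM leaf
`Summit.Ventures.QEC.BB.BB72_12_6_claim` (`HasParams BB.bb72 72 12 6`), never a summit Statement
(Ventures/QEC has none). No idea card.
Lean: `(∀ v : Literature.InformationTheory.QuantumCodes.BB.Mono 6 6 ⊕
Literature.InformationTheory.QuantumCodes.BB.Mono 6 6 → ZMod 2, Matrix.mulVec
(Literature.InformationTheory.QuantumCodes.BB.bb72).css.HX v = 0 → v ∉
(Literature.InformationTheory.QuantumCodes.BB.bb72).css.rowSpZ → 6 ≤ hammingNorm v) ∧ (∃ v :
Literature.InformationTheory.QuantumCodes.BB.Mono 6 6 ⊕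
Literature.InformationTheory.QuantumCodes.BB.Mono 6 6 → ZMod 2, Matrix.mulVec
(Literature.InformationTheory.QuantumCodes.BB.bb72).css.HX v = 0 ∧ v ∉
(Literature.InformationTheory.QuantumCodes.BB.bb72).css.rowSpZ ∧ hammingNorm v = 6) ∧
(Literature.InformationTheory.QuantumCodes.BB.bb72).k = 12`

## Assembly
Pure logic over three tree lemmas: from `WeightSixZLogical` take v; `CSSCode.dZ_eq_of_witness hv hv'
hwt NoZLogicalBelowSix : BB.bb72.css.dZ = 6`;
`Summit.Ventures.QEC.BB.numQubits_claims.1 : BB.numQubits 6 6 = 72` (counting, proved);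
`TwelveLogicalQubits : BB.bb72.k = 12`; then
`Summit.Ventures.QEC.BB.hasParams_of_dZ` (d = d^Z, Lemma 1, proved) gives `HasParams BB.bb72 72 12 6
= BB72_12_6_claim`. The deciding theorem
`closes` in glue.lean is exactly this, routed through `Assembly` and `Target` so both are in its
cone (lean check rc 0, 0 sorries).

CLOSES_TARGET: closes rung Q2 of Ventures/QEC: Summit.Ventures.QEC.BB.BB72_12_6_claim (D-0061; not the summit Statement) — the deciding theorem of this route concludes that registered leaf (Ventures/QEC: no summit Statement) (class rung: servable and labelled, never counted as concluding the summit Statement).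

Rationale: WHY THIS LINE. The mechanism is the certificate shape of `CSSCode.dZ_eq_of_witness` (tree,
CSS.lean): an explicit logical of weight d plus the universally
checked statement "every logical has weight ≥ d" give d^Z = d, and for every QC(A, B) d = d^Z = d^X
(Lemma 1 of [BravyiEtAl2024],
arXiv:2308.07915 §4, proved in the tree as `BB.Code.d_eq_dZ`), so one side suffices (cell CERT-REQS
C8). The lower bound is the only
expensive conjunct: it is discharged by certificates the cell already holds and a referee has
ROW-SIGNED (certA = search-1 bruteforce
enumeration sha16 7e943c5a566adc43; certB = search-2 CNF→CaDiCaL→LRAT sha16 1e757ed06e233576,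
lemma-free encoding enc-v1; ref-1
ROW-SIGNED 2026-08-26T18:10:21Z, assumes=none), replayed in Lean by type-10's checker
`Summits/Ventures/QEC/Census/CertCheck.lean`
(`checkDistCert` + soundness, p461106) on the flat matrices `BB.bb72.HXFlat/HZFlat` and transported
to `BB.bb72.css` by the landed bridge
`BB.Code.dZ_eq_of_flat` / `cssFlat_dZ` / `cssFlat_k`. Imported from coding theory:
Brouwer–Zimmermann / information-set enumeration
(search-7's measured single-information-set variant: 974 981 DFS nodes per side) and DRAT/LRAT proof
logging for the UNSAT side. What the line
does that print does not: Nature ED Table 1 reports a MIP optimum with no checkable artefact; this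
route makes [[72,12,6]] a kernel-checked theorem.

RANKED CRUXES. #0 Target (target) — the printed row — QC(x³+y+y², y³+x+x²) on ℤ₆ × ℤ₆ has parameters
[[72, 12, 6]] (n = 72 data qubits, k = 12, distance EXACTLY 6). (why it might fail: only if the
printed MIP distance or dimension is wrong — four independent cell kernels (bruteforce, CNF/LRAT,
Brouwer–Zimmermann, matrix-method) agree on 12 and 6.) [BravyiEtAl2024, arXiv:2308.07915]
#2 NoZLogicalBelowSix (crux) — LOWER BOUND — every v with H^X v = 0 and v ∉ rowspace(H^Z) (a Z-type
logical operator of BB.bb72) has Hamming weight ≥ 6; equivalently no Z-logical of weight ≤ 5 exists.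
Discharged by a kernel-replayed enumeration / UNSAT certificate (certA bruteforce 7e943c5a566adc43,
certB LRAT 1e757ed06e233576, or search-7's information-set certificate), via `CertCheck` soundness +
`BB.Code.dZ_eq_of_flat`. [difficulty: M] (why it might fail: false iff a Z-logical of weight ≤ 5
exists (printed d by MIP, uncertified); residual risk after two signed certificates = an
index-convention slip between the checker's flat literal and `BB.bb72` (x = S_6 ⊗ I_6 vs I ⊗ S).)
[BravyiEtAl2024, arXiv:2308.07915, Vardy1997, KapshikarKundu2023]
#3 WeightSixZLogical (crux) — UPPER WITNESS — there is an explicit v with H^X v = 0, v ∉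
rowspace(H^Z) and |v| = 6 (a weight-6 Z-type logical operator); the certificates list one (certA
`upper.Z.word`), non-membership in rowspace(H^Z) is a rank / syndrome check decidable on the literal
matrices. [difficulty: S] (why it might fail: false iff d ≥ 7 (every weight-6 kernel word of H^X is
a Z-stabiliser); the listed witness could be mis-transcribed or secretly in rowspace(H^Z) — the
non-membership proof is the delicate part in Lean.) [BravyiEtAl2024, arXiv:2308.07915]
#9 TwelveLogicalQubits (support) — DIMENSION — k(BB.bb72) = 72 − rk H^X − rk H^Z = 12 (rk H^X = rk
H^Z = 30 over 𝔽₂), by a rank certificate (type-02's Census/RankCert.lean p462257) transported with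
`BB.Code.cssFlat_k`; equivalently k = 2·dim(ker A ∩ ker B) (Lemma 1). [difficulty: provable-now]
[BravyiEtAl2024, arXiv:2308.07915, CalderbankShor1996]

TWO-LAYER PLAN. Foreseen split of NoZLogicalBelowSix only if the monolithic kernel replay is too
heavy: NoZLogicalBelowSix ⇐ (checker soundness: `checkDistCert cert = true → ∀ v, …` on the flat
code, type-10 CertCheck) → (the data fact `checkDistCert cert = true`, by `decide +kernel` in ≤
400-line chunk files, search-7 emitter; or the information-set variant, one light file per side) →
NoZLogicalBelowSix via `BB.Code.dZ_eq_of_flat`; k ≤ 3 children, depth 1. Nothing filed now.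

KILL CRITERIA. A kernel-checked Z-logical (or X-logical, d^X = d^Z) of weight ≤ 5 refutes
NoZLogicalBelowSix and the CLAIM itself (route closes refuted:NoZLogicalBelowSix and the census row
becomes a DISCREPANCY finding against Nature 627 Table 1); a proof that rk H^X ≠ 30 refutes
TwelveLogicalQubits likewise. A proof of `BB72_12_6_claim` landed by any other cell file (e.g.
search-7's CertNative/Kernel files + Distance.lean discharging the claim directly) moots the route —
it is then closed superseded with the discharging theorem named.

NOT DECOMPOSED YET. The checker-soundness / data-fact split of the lower bound (Two-layer plan), the
X-side mirror statements (unnecessary: d^X = d^Z is a tree theorem), and the per-chunk leaf theorems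
of the kernel replay — all are prover-side packaging below item level (attached with --supports
NoZLogicalBelowSix), never items.

CHEAPEST FALSIFIER. Run any distance tool on the 36×72 matrices H^X = [A|B], H^Z = [Bᵀ|Aᵀ] of
BB.bb72 and look for a logical of weight ≤ 5. Done four ways inside the cell before filing: search-1
bruteforce (all C(72,≤5) supports per side, certA 7e943c5a566adc43), search-2 CNF + CaDiCaL UNSAT
with LRAT proof (certB 1e757ed06e233576), search-9 matrix-method cross-check, search-4 MILP — all
agree d = 6, k = 12; ref-1 replayed both certificates independently and ROW-SIGNED
(2026-08-26T18:10:21Z). search-7 additionally evaluated type-10's Lean `checkDistCert` on the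
emitted literal by native_decide in 34.8 s (true).

NUMBERS. n = 72 = 2·6·6; k = 12; d = d^X = d^Z = 6 (Nature 627 Table 1 row 1: "[[72,12,6]] 1/12");
rk H^X = rk H^Z = 30; enumeration size per side for the lower bound: Σ_{w≤5} C(72,w) ≈ 1.5·10⁷
supports (bruteforce) or 974 981 DFS nodes (single information set, 42 kernel-basis vectors); LRAT
proof sizes per side ≤ 60 MB (certB family).

DEFINITION REQUESTS. None: `BB.Code`, `BB.bb72`, `CSSCode.dZ/dX/k/rowSpZ`, `hammingNorm`,
`HasParams`, the flat bridge `BB.Code.cssFlat` (+ `dZ_eq_of_flat`, `cssFlat_k`) and the checker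
`Census/CertCheck.lean` are all in the tree. Cite fact wanted: none (BravyiEtAl2024 is in
references.bib; the claim decl carries the locators).

Novelty: Searches (2026-08-26): lit search "bivariate bicycle code distance" (6 local docs: arXiv:2308.07915,
2502.20189, 2510.06495, 2411.03302, 2605.14173, 2503.22071; 13 remote merged, OpenAlex/S2
rate-limited); lit galaxy search "bivariate bicycle|[[72,12,6]]|BB code distance" --star all (panama
0, pdf 5 decoder papers, crabby 0); cell literature seats lit-3 (LIT-3-CONSTRUCTIONS.md v1.1: "how d
was established in print" = MILP for all five BB rows, Nature ED Table 1 caption p0011) and lit-1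
(LIT-1-REGISTER.md: families with proved d vs exhaustive/LP vs upper-bound-only).
Nearest prior art found: BravyiEtAl2024 = arXiv:2308.07915 (Nature 627, 778) Table 1 / ED Table 1 —
the parameters by mixed-integer programming (their ref. 68), no certificate; arXiv:2502.20189 Table
I reprints the row; QDistRnd-style randomized upper bounds (Pryadko et al.) for related two-block
codes (lit-3 A2/A3).
Delta: the first kernel-checked (Lean) certificate that QC(x³+y+y², y³+x+x²) on ℤ₆×ℤ₆ has distance
exactly 6 and k = 12 — print has solver output only; the mathematics is known, the certification is
new.
Claimed grade: known  [refs: 2308.07915, 2502.20189, BravyiEtAl2024]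

Barriers (technique_class: certified-computation, enumeration, unsat-cert): - technique_class: certified-computation, enumeration, unsat-cert
- Literature.Barriers.Ventures: no catalogued barrier directory exists for Ventures (ls
lean/Literature/Barriers/ has none); the technique-class barrier is NP-hardness of minimum distance
—
`Literature.InformationTheory.QuantumCodes.MinimumDistanceHardness.Vardy1997_minimumDistance_isNPComplete`
and `KapshikarKundu2023_quantumMinimumDistance_isNPHard` (tree, named facts): they bound the
asymptotic cost of a uniform algorithm, not a fixed instance — n = 72, w ≤ 5 is ≈ 1.5·10⁷ supports
per side, enumerated and kernel-replayed outright; the route does not claim a method that scales.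
- Negatives index: empty for Ventures/QEC at filing (ledger negatives --problem Ventures consulted
by the cell's refuter seats; no refuted statement about BB codes).

History (route lifecycle, newest last):
- 2026-08-26T21:01:32Z · CLOSED proved — proved:Summit.Ventures.QEC.Census.BB72.BB72_12_6_claim_holds (operator:999:1122764)

sub-problem: QEC · status: closed(proved) · opened operator:999:2039486 2026-08-26T19:29:51Z · rev 0 · ledger route-Ventures-BB72DistanceCertificate
GENERATED by the gate from the ledger (D-0016/17). Provers cite these decls: `theorem foo : Summit.Ventures.QEC.Theses.BB72DistanceCertificate.<Decl> := …` in Summits/Ventures/QEC/Theorems/<Name>.lean.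
-/

namespace Summit.Ventures.QEC.Theses.BB72DistanceCertificate

open scoped BigOperators Topology Manifold Classical MeasureTheory ProbabilityTheory Matrix InnerProductSpace ComplexConjugate ContinuousMap
open Filter Set Function TopologicalSpace MeasureTheory

-- H21.Audit: Ventures rung route — no summit Statement decl; the expected conclusion is the closer leaf tagged below
attribute [summit_statement] _root_.Summit.Ventures.QEC.BB.BB72_12_6_claim

/-- item stmt-Ventures-19876 · target · rank 0 · closed · proved by Summit.Ventures.QEC.Census.BB72.target_proof (prover) · by operator
why it might fail: only if the printed MIP distance or dimension is wrong — four independent cell kernels (bruteforce, CNF/LRAT, Brouwer–Zimmermann, matrix-method) agree on 12 and 6.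
sources: BravyiEtAl2024, arXiv:2308.07915
[target] the printed row — QC(x³+y+y², y³+x+x²) on ℤ₆ × ℤ₆ has parameters [[72, 12, 6]] (n = 72 data
qubits, k = 12, distance EXACTLY 6). -/
@[route_item "route-Ventures-BB72DistanceCertificate"]
def Target : Prop :=
  Summit.Ventures.QEC.BB.BB72_12_6_claim

-- `Target` holds: proved by `Summit.Ventures.QEC.Census.BB72.target_proof` (its module imports this route file, so no `_holds` link can be stated here).

/-- item stmt-Ventures-19877 · crux · rank 2 · closed · proved by Summit.Ventures.QEC.Theorems.noZLogicalBelowSix_proof (prover) · by operator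
why it might fail: false iff a Z-logical of weight ≤ 5 exists (printed d by MIP, uncertified); residual risk after two signed certificates = an index-convention slip between the checker's flat literal and `BB.bb72` (x = S_6 ⊗ I_6 vs I ⊗ S).
sources: BravyiEtAl2024, arXiv:2308.07915, Vardy1997, KapshikarKundu2023
[crux] LOWER BOUND — every v with H^X v = 0 and v ∉ rowspace(H^Z) (a Z-type logical operator of
BB.bb72) has Hamming weight ≥ 6; equivalently no Z-logical of weight ≤ 5 exists. Discharged by a
kernel-replayed enumeration / UNSAT certificate (certA bruteforce 7e943c5a566adc43, certB LRAT
1e757ed06e233576, or search-7's information-set certificate), via `CertCheck` soundness +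
`BB.Code.dZ_eq_of_flat`. [difficulty: M] -/
@[route_item "route-Ventures-BB72DistanceCertificate"]
def NoZLogicalBelowSix : Prop :=
  ∀ v : Literature.InformationTheory.QuantumCodes.BB.Mono 6 6 ⊕ Literature.InformationTheory.QuantumCodes.BB.Mono 6 6 → ZMod 2, Matrix.mulVec (Literature.InformationTheory.QuantumCodes.BB.bb72).css.HX v = 0 → v ∉ (Literature.InformationTheory.QuantumCodes.BB.bb72).css.rowSpZ → 6 ≤ hammingNorm v

-- `NoZLogicalBelowSix` holds: proved by `Summit.Ventures.QEC.Theorems.noZLogicalBelowSix_proof` (its module imports this route file, so no `_holds` link can be stated here).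

/-- item stmt-Ventures-19878 · crux · rank 3 · closed · proved by Summit.Ventures.QEC.Census.BB72.weightSixZLogical_proof (prover) · by operator
why it might fail: false iff d ≥ 7 (every weight-6 kernel word of H^X is a Z-stabiliser); the listed witness could be mis-transcribed or secretly in rowspace(H^Z) — the non-membership proof is the delicate part in Lean.
sources: BravyiEtAl2024, arXiv:2308.07915
[crux] UPPER WITNESS — there is an explicit v with H^X v = 0, v ∉ rowspace(H^Z) and |v| = 6 (a
weight-6 Z-type logical operator); the certificates list one (certA `upper.Z.word`), non-membership
in rowspace(H^Z) is a rank / syndrome check decidable on the literal matrices. [difficulty: S] -/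
@[route_item "route-Ventures-BB72DistanceCertificate"]
def WeightSixZLogical : Prop :=
  ∃ v : Literature.InformationTheory.QuantumCodes.BB.Mono 6 6 ⊕ Literature.InformationTheory.QuantumCodes.BB.Mono 6 6 → ZMod 2, Matrix.mulVec (Literature.InformationTheory.QuantumCodes.BB.bb72).css.HX v = 0 ∧ v ∉ (Literature.InformationTheory.QuantumCodes.BB.bb72).css.rowSpZ ∧ hammingNorm v = 6

-- `WeightSixZLogical` holds: proved by `Summit.Ventures.QEC.Census.BB72.weightSixZLogical_proof` (its module imports this route file, so no `_holds` link can be stated here).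

/-- item stmt-Ventures-19879 · support · rank 9 · closed · proved by Summit.Ventures.QEC.Theorems.TwelveLogicalQubits_proof (prover) · by operator
sources: BravyiEtAl2024, arXiv:2308.07915, CalderbankShor1996
[support] DIMENSION — k(BB.bb72) = 72 − rk H^X − rk H^Z = 12 (rk H^X = rk H^Z = 30 over 𝔽₂), by a
rank certificate (type-02's Census/RankCert.lean p462257) transported with `BB.Code.cssFlat_k`;
equivalently k = 2·dim(ker A ∩ ker B) (Lemma 1). [difficulty: provable-now] -/
@[route_item "route-Ventures-BB72DistanceCertificate"]
def TwelveLogicalQubits : Prop :=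
  (Literature.InformationTheory.QuantumCodes.BB.bb72).k = 12

-- `TwelveLogicalQubits` holds: proved by `Summit.Ventures.QEC.Theorems.TwelveLogicalQubits_proof` (its module imports this route file, so no `_holds` link can be stated here).

/-- item stmt-Ventures-19880 · assembly · rank 1 · closed · proved by Summit.Ventures.QEC.Census.BB72.assembly_proof (prover) · by operator
sources: BravyiEtAl2024
[assembly] NoZLogicalBelowSix → WeightSixZLogical → TwelveLogicalQubits → the [[72,12,6]] claim. -/
@[route_item "route-Ventures-BB72DistanceCertificate"]
def Assembly : Prop :=
  NoZLogicalBelowSix → WeightSixZLogical → TwelveLogicalQubits → Summit.Ventures.QEC.BB.BB72_12_6_claim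

-- `Assembly` holds: proved by `Summit.Ventures.QEC.Census.BB72.assembly_proof` (its module imports this route file, so no `_holds` link can be stated here).

/-! D-0027 §2.1 — DECIDING THEOREM (planner-authored via `route open/edit --closes-file`; by operator:999:2039486 2026-08-26T19:29:51Z) — ARCHIVED: route closed (proved) 2026-08-26T21:01:32Z; kept so importers keep building:
its hypotheses are this route's items and its conclusion the registered leaf `Summit.Ventures.QEC.BB.BB72_12_6_claim` (rung Q2, D-0061) (glue_lint), and it elaborates with this file. -/

/-- **Deciding theorem of route BB72DistanceCertificate** (Ventures/QEC rung Q2; D-0027 §2.1, D-0059/D-0061/D-0092: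
closes_target = the registered CLAIM leaf `Summit.Ventures.QEC.BB.BB72_12_6_claim`, never a summit Statement).
Lower bound + explicit weight-6 witness ⇒ `d^Z(BB.bb72) = 6` (`CSSCode.dZ_eq_of_witness`); `n = 72` by counting
(`numQubits_claims.1`); `k = 12` (support item); then `hasParams_of_dZ` (Lemma 1 of Bravyi et al.: `d = d^Z`, tree theorem
`BB.Code.d_eq_dZ`). Routed THROUGH `Assembly` and `Target` so both decls are in the cone of `closes`; every binder load-bearing;
fully qualified names, no `open`. -/
@[closes "route-Ventures-BB72DistanceCertificate"] theorem closes (hL : NoZLogicalBelowSix) (hU : WeightSixZLogical) (hK : TwelveLogicalQubits) :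
    Summit.Ventures.QEC.BB.BB72_12_6_claim := by
  have hA : Assembly := fun hL' hU' hK' => by
    obtain ⟨v, hv, hv', hwt⟩ := hU'
    exact Summit.Ventures.QEC.BB.hasParams_of_dZ Summit.Ventures.QEC.BB.numQubits_claims.1 hK'
      ((Literature.InformationTheory.QuantumCodes.BB.bb72).css.dZ_eq_of_witness hv hv' hwt hL')
  have hT : Target := hA hL hU hK
  exact hT

end Summit.Ventures.QEC.Theses.BB72DistanceCertificate
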